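import Summits.NavierStokesRegularity.NavierStokesRegularity.Theses.RellichScar
import Summits.NavierStokesRegularity.NavierStokesRegularity.Theorems.SymmetricScarExists.Negative.SpiralWorld
import Summits.NavierStokesRegularity.NavierStokesRegularity.Theorems.RellichScarScarRigidityApexMild
import Summits.NavierStokesRegularity.NavierStokesRegularity.Theorems.ExtremalTypeIConstantSmallConstantLiouville
import Literature.Analysis.FluidPDE.LocalTypeI
import Literature.Analysis.FluidPDE.LocalTypeICongr
import Literature.Analysis.FluidPDE.LocalTypeILiouville
import Literature.Analysis.FluidPDE.TypeIAncientMild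

/-!
# Crux `SymmetricScarExists` (stmt-NavierStokesRegularity-11718): the small-constant fragment

Helper file of the line lead (`--supports stmt-NavierStokesRegularity-11718`; theorems only, no definitions, no
named facts).  The only UNCONDITIONAL fragment of the crux in sight (Disproof §10/§11; Koch–Nadirashvili–
Seregin–Šverák 2009, §4 p. 8 and §6: the gap below the Type-I constants of non-trivial ancient solutions;
Chae–Wolf 2017, Rmk 1.4): below the KNSS threshold `c₀ = 1/(8 C₀)`, `C₀` the Oseen slice constant, the
antecedent class of the crux is EMPTY — no suitable weak solution on the slab with a weak gradient, `𝐈 < ∞`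
and the apex bound `‖u‖ ≤ C/(‖x‖ + √(−t))`, `C < c₀`, is singular at the origin — so every instance `C < c₀`
of `SymmetricScarExists` (and of the target `NoApexTypeIProfile`) holds outright.

* `no_singular_apex_profile_smallConstant` (registered auxiliary stub): `∃ c₀ > 0, ∀ C < c₀`, no singular apex
  profile of constant `C`.  Proof: for `C ≤ 0` the bound forces `u = 0` on `t < 0`; for `0 < C < c₀` the
  profile is a.e. a Type-I ancient mild field (`stub_apexMildRepresentative`, KNSS Lemma 3.1 + Prop. 4.1),
  which vanishes by the tree's small-constant Liouville theorem `smallConstantLiouville_eq_zero` (route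
  ExtremalTypeIConstant, KNSS §4); an a.e.-zero field has no backward-singular point.
* `symmetricScarExists_smallConstant` — the crux's instances `C < c₀` (vacuously).

References: G. Koch, N. Nadirashvili, G. Seregin, V. Šverák, Acta Math. 203 (2009) 83–105 = arXiv:0709.3599,
Lemma 3.1, §4 Prop. 4.1 and p. 8, §6 [KNSS2009]; D. Chae, J. Wolf, arXiv:1610.09464, Rmk 1.4
[ChaeWolf2017RemovingDSS]; D. Albritton, T. Barker, arXiv:1811.00502, §1 [AlbrittonBarker2019].
-/

noncomputable section

open MeasureTheory Set Function Filter Topology TopologicalSpace Metric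
open scoped NNReal ENNReal

namespace Summit.NavierStokesRegularity.NavierStokesRegularity.Theorems.SymmetricScarExists.ScarWindow

open Literature.Analysis.FluidPDE
open Summit.NavierStokesRegularity.NavierStokesRegularity.Theses.RellichScar
open Summit.NavierStokesRegularity.NavierStokesRegularity.Theorems.SymmetricScarExists.Negative
open Summit.NavierStokesRegularity.NavierStokesRegularity.Theorems.RellichScarScarRigidity (stub_apexMildRepresentative)
open Summit.NavierStokesRegularity.NavierStokesRegularity.Theorems (smallConstantLiouville_eq_zero)

set_option linter.dupNamespace false

/-- A field vanishing almost everywhere on the slab `(−∞,0) × ℝ³` has no backward-singular point at the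
space–time origin: its `L^∞` norm on `Q(0, 1)` is `0`, not `∞`. [cite: AlbrittonBarker2019, §1] -/
theorem not_isBackwardSingularPoint_of_ae_zero_slab {u : ℝ → EuclideanSpace ℝ (Fin 3) → EuclideanSpace ℝ (Fin 3)}
    (h0 : ∀ᵐ w ∂(volume.restrict (Iio (0 : ℝ) ×ˢ (univ : Set (EuclideanSpace ℝ (Fin 3))))), uncurry u w = 0) :
    ¬ IsBackwardSingularPoint u 0 := by
  intro hs
  have hz' : ∀ᵐ z ∂(volume.restrict (parabolicCylinder 1 (0 : ℝ × EuclideanSpace ℝ (Fin 3)))),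
      uncurry u z = (0 : ℝ × EuclideanSpace ℝ (Fin 3) → EuclideanSpace ℝ (Fin 3)) z :=
    ae_restrict_of_ae_restrict_of_subset (parabolicCylinder_origin_subset_slab 1) h0
  have h1 := hs 1 one_pos
  rw [eLpNorm_congr_ae hz', eLpNorm_zero] at h1
  exact ENNReal.zero_ne_top h1

/-- A field with the apex bound of a NONPOSITIVE constant vanishes identically on `t < 0`. [folklore] -/
theorem eq_zero_of_hasTypeIDecay_nonpos {C : ℝ} (hC : C ≤ 0) {u : ℝ → EuclideanSpace ℝ (Fin 3) → EuclideanSpace ℝ (Fin 3)}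
    (hdec : HasTypeIDecay C u) {t : ℝ} (ht : t < 0) (x : EuclideanSpace ℝ (Fin 3)) : u t x = 0 := by
  have hden : 0 < ‖x‖ + Real.sqrt (-t) :=
    add_pos_of_nonneg_of_pos (norm_nonneg _) (Real.sqrt_pos.2 (neg_pos.2 ht))
  have h := hdec t ht x
  have hle : ‖u t x‖ ≤ 0 := h.trans (div_nonpos_of_nonpos_of_nonneg hC hden.le)
  exact norm_le_zero_iff.1 hle

/-- **No singular apex profile below the KNSS gap** (registered auxiliary stub
`no_singular_apex_profile_smallConstant` of crux stmt-NavierStokesRegularity-11718): there is `c₀ > 0` — the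
small-constant Liouville threshold `1/(8 C₀)` of the tree's `smallConstantLiouville_eq_zero` — such that for
`C < c₀` no suitable weak solution on the slab with a weak gradient, `𝐈 < ∞` and the apex bound of constant
`C` is singular at the origin: for `C ≤ 0` the field vanishes on `t < 0`; for `0 < C < c₀` it is a.e. a Type-I
ancient mild field (KNSS Lemma 3.1 + Prop. 4.1, `stub_apexMildRepresentative`), which vanishes by the
small-constant Liouville theorem (KNSS §4 p. 8); an a.e.-zero field has no singular point.
[cite: KochNadirashviliSereginSverak2009, §4 p. 8 and §6 (arXiv:0709.3599)] -/
theorem no_singular_apex_profile_smallConstant :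
    ∃ c₀ : ℝ, 0 < c₀ ∧ ∀ C : ℝ, C < c₀ → ¬ (∃ (u : ℝ → EuclideanSpace ℝ (Fin 3) → EuclideanSpace ℝ (Fin 3)) (p : ℝ → EuclideanSpace ℝ (Fin 3) → ℝ) (G : ℝ → EuclideanSpace ℝ (Fin 3) → EuclideanSpace ℝ (Fin 3) →L[ℝ] EuclideanSpace ℝ (Fin 3)), IsSuitableWeakSolutionOn (slab (EuclideanSpace ℝ (Fin 3)) (Iio (0 : ℝ)) isOpen_Iio) 1 0 u p ∧ HasWeakSpatialGradientOn (slab (EuclideanSpace ℝ (Fin 3)) (Iio (0 : ℝ)) isOpen_Iio) u G ∧ typeIBound (Iio (0 : ℝ) ×ˢ univ) u p G < ⊤ ∧ HasTypeIDecay C u ∧ IsBackwardSingularPoint u 0) := by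
  refine ⟨1 / (8 * oseenSliceConst (EuclideanSpace ℝ (Fin 3))),
    by have := oseenSliceConst_pos (E := EuclideanSpace ℝ (Fin 3)); positivity, ?_⟩
  rintro C hC ⟨u, p, G, hsw, hwg, hI, hdec, hsing⟩
  rcases le_or_gt C 0 with hC0 | hC0
  · -- `C ≤ 0`: the field vanishes on the open slab
    refine not_isBackwardSingularPoint_of_ae_zero_slab (u := u) ?_ hsing
    filter_upwards [ae_restrict_mem (measurableSet_Iio.prod MeasurableSet.univ)] with w hw
    exact eq_zero_of_hasTypeIDecay_nonpos hC0 hdec hw.1 w.2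
  · -- `0 < C < c₀`: a.e. a Type-I ancient mild field, which vanishes by the small-constant Liouville theorem
    obtain ⟨V, hae, hmild, -⟩ := stub_apexMildRepresentative u p G C hC0 hsw hwg hI hdec
    refine not_isBackwardSingularPoint_of_ae_zero_slab (u := u) ?_ hsing
    filter_upwards [hae, ae_restrict_mem (measurableSet_Iio.prod MeasurableSet.univ)] with w hw hmem
    rw [← hw]
    exact smallConstantLiouville_eq_zero hmild hC hmem.1 w.2

/-- **The crux below the KNSS gap**: every instance `C < c₀` of `SymmetricScarExists` holds (vacuously — the
antecedent class is empty there). [cite: KochNadirashviliSereginSverak2009, §4 p. 8 and §6 (arXiv:0709.3599)] -/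
theorem symmetricScarExists_smallConstant :
    ∃ c₀ : ℝ, 0 < c₀ ∧ ∀ C : ℝ, C < c₀ → (∃ (u : ℝ → EuclideanSpace ℝ (Fin 3) → EuclideanSpace ℝ (Fin 3)) (p : ℝ → EuclideanSpace ℝ (Fin 3) → ℝ) (G : ℝ → EuclideanSpace ℝ (Fin 3) → EuclideanSpace ℝ (Fin 3) →L[ℝ] EuclideanSpace ℝ (Fin 3)), IsSuitableWeakSolutionOn (slab (EuclideanSpace ℝ (Fin 3)) (Iio (0 : ℝ)) isOpen_Iio) 1 0 u p ∧ HasWeakSpatialGradientOn (slab (EuclideanSpace ℝ (Fin 3)) (Iio (0 : ℝ)) isOpen_Iio) u G ∧ typeIBound (Iio (0 : ℝ) ×ˢ univ) u p G < ⊤ ∧ HasTypeIDecay C u ∧ IsBackwardSingularPoint u 0) →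
      ∃ (C' : ℝ) (u : ℝ → EuclideanSpace ℝ (Fin 3) → EuclideanSpace ℝ (Fin 3)) (p : ℝ → EuclideanSpace ℝ (Fin 3) → ℝ) (G : ℝ → EuclideanSpace ℝ (Fin 3) → EuclideanSpace ℝ (Fin 3) →L[ℝ] EuclideanSpace ℝ (Fin 3)),
        IsSuitableWeakSolutionOn (slab (EuclideanSpace ℝ (Fin 3)) (Iio (0 : ℝ)) isOpen_Iio) 1 0 u p ∧ HasWeakSpatialGradientOn (slab (EuclideanSpace ℝ (Fin 3)) (Iio (0 : ℝ)) isOpen_Iio) u G ∧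
        typeIBound (Iio (0 : ℝ) ×ˢ univ) u p G < ⊤ ∧ HasTypeIDecay C' u ∧
        IsBackwardSingularPoint u 0 ∧ (HomScar u ∨ AxiScar u) := by
  obtain ⟨c₀, hc₀, hno⟩ := no_singular_apex_profile_smallConstant
  exact ⟨c₀, hc₀, fun C hC hex => absurd hex (hno C hC)⟩

end Summit.NavierStokesRegularity.NavierStokesRegularity.Theorems.SymmetricScarExists.ScarWindow

end
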